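import Mathlib

/-!
# Nine-eighths law — kernel skeleton (anomaly g17; READING-1 letter bookkeeping, nothing toward HC ∕ 18881)

`line stmt-HodgeConjecture-18881 Cruxes/BlochSeedDiscOne/Lines/birth.lean 814a6a70c14e831a stub_rung_pad4_seedAt`

Self-contained (Mathlib only).  v1.1 (namespace aligned to the tree convention — officer PLATE #29 nit; §3 SHELL-GENERIC closed forms added for the
CORE memo `SHELL-CORE-v0-anomaly-g17.md` §2.2).  Three parts:

* **§1 the cell table as a kernel fact.**  Letter classes of the height-14, ring-3 alphabet by
  `(col, 2|xy|)`: `H (0,0)`, `u (1,0)`, `A (2,0)`, `B (2,2)`, `C (3,0)`, `D (3,4)`.  The certificate functional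
  `phi16 = 16·Φ′ = Σ₁₂ q·r·r + Σ₆ q·q − Σ₁₂ q·q·r + 3·Σ₄ q·r·r·r` (sums over slot placements of the umbral words
  `(q r r 1)`, `(q q 1 1)`, `(q q r 1)`, `(q r r r)`) satisfies, by `decide` over all `6⁴ = 1296` class 4-tuples:
  `0 ≤ phi16` everywhere; `phi16 ≤ 16` on every H-bearing tuple outside the nine HEAVY shapes
  `DDHu ABDH ACDH ADDH BCCH BCDH BDDH CCDH CDDH` (all absent from the fine v2 room 8940f2df8ed13676 ≡ 39472e91b29ca2b5);
  `phi16 = 0` on axis tuples (letters `u A C` and `H`).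
* **§2 the law from the identity.**  For any finitely supported two-term mass assignment, the identity
  `Σ_P m·(phi16 − 18ρ) = Σ_N m·(phi16 − 18ρ)` (= 16 × (N1), which is the combination
  `(1/16)(12·mid_law + 6·pair_law) + 0·degFive` of the kernel laws of `ShellThreePairLaw` v11 — typed against that
  module once the farm snapshot builds it) together with the §1 bounds and the regime
  (R1: every N cell has a hub; hub-free P cells are axis cells) gives `9·S ≤ 8·(H-bearing P mass)`, `S = Σ_{P hub-free} m·ρ`.
-/

set_option linter.dupNamespace false
set_option autoImplicit false

namespace Summit.HodgeConjecture.HodgeConjecture.Cruxes.BlochSeedDiscOne.NineEighths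

set_option maxRecDepth 1000000

/-- letter classes of the ring-3 alphabet at height 14 -/
inductive LC | H | u | A | B | C | D
  deriving DecidableEq, Repr, Fintype

namespace LC

/-- `col = |x| + |y|` -/
def r : LC → ℤ
  | H => 0 | u => 1 | A => 2 | B => 2 | C => 3 | D => 3

/-- `2·|x|·|y|` -/
def q : LC → ℤ
  | B => 2 | D => 4 | _ => 0

/-- axis letter (single phase): `u`, `A`, `C` (and the hub) -/
def axis : LC → Bool
  | B => false | D => false | _ => true

end LC

open LC

/-- a class cell = the four slot classes -/
abbrev Cell := LC × LC × LC × LC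

namespace Cell

variable (c : Cell)

def s1 : LC := c.1
def s2 : LC := c.2.1
def s3 : LC := c.2.2.1
def s4 : LC := c.2.2.2

/-- `16·Φ′`: `Σ₁₂ q r r (1)` + `Σ₆ q q (1 1)` − `Σ₁₂ q q r (1)` + `3·Σ₄ q r r r`, written out over slot placements. -/
def phi16 (c : Cell) : ℤ :=
  let a := c.1; let b := c.2.1; let d := c.2.2.1; let e := c.2.2.2
  -- (q r r 1): q at one slot, 1 at another, r at the remaining two  (12 placements)
  ( q a * (r b * r d + r b * r e + r d * r e)
  + q b * (r a * r d + r a * r e + r d * r e)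
  + q d * (r a * r b + r a * r e + r b * r e)
  + q e * (r a * r b + r a * r d + r b * r d) )
  -- (q q 1 1): 6 pairs
  + ( q a * q b + q a * q d + q a * q e + q b * q d + q b * q e + q d * q e )
  -- (q q r 1): pair {k,l}, r at one of the other two slots (12 placements)
  - ( q a * q b * (r d + r e) + q a * q d * (r b + r e) + q a * q e * (r b + r d)
    + q b * q d * (r a + r e) + q b * q e * (r a + r d) + q d * q e * (r a + r b) )
  -- (q r r r): 4 placements, weight 3
  + 3 * ( q a * r b * r d * r e + q b * r a * r d * r e + q d * r a * r b * r e + q e * r a * r b * r d )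

/-- `ρ = Π col` (= `dep` of a hub-free axis cell) -/
def rho (c : Cell) : ℤ := r c.1 * r c.2.1 * r c.2.2.1 * r c.2.2.2

/-- H-bearing: some slot is the hub -/
def hb (c : Cell) : Bool := c.1 = H || c.2.1 = H || c.2.2.1 = H || c.2.2.2 = H

/-- number of slots carrying a given class -/
def cnt (c : Cell) (x : LC) : ℕ :=
  (if c.1 = x then 1 else 0) + (if c.2.1 = x then 1 else 0) + (if c.2.2.1 = x then 1 else 0) + (if c.2.2.2 = x then 1 else 0)

/-- the nine HEAVY one-hub shapes `DDHu ADDH BDDH CDDH ABDH ACDH BCDH CCDH BCCH` (Φ′ > 1; absent from the fine room) -/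
def heavy (c : Cell) : Bool :=
  cnt c H = 1 &&
  ( (cnt c D = 2 && (cnt c u = 1 || cnt c A = 1 || cnt c B = 1 || cnt c C = 1))
  || (cnt c D = 1 && ((cnt c A = 1 && cnt c B = 1) || (cnt c A = 1 && cnt c C = 1) || (cnt c B = 1 && cnt c C = 1) || cnt c C = 2))
  || (cnt c D = 0 && cnt c B = 1 && cnt c C = 2) )

/-- axis cell: every slot an axis letter or the hub -/
def axisCell (c : Cell) : Bool := axis c.1 && axis c.2.1 && axis c.2.2.1 && axis c.2.2.2

end Cell

open Cell

/-- **(T2)** `Φ′ ≥ 0` on every class cell (so the N side of the identity needs no door and no regime for its sign). -/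
theorem phi16_nonneg : ∀ c : Cell, 0 ≤ phi16 c := by decide

/-- **(T1)** `Φ′ ≤ 1` on every H-bearing class cell outside the nine heavy shapes. -/
theorem phi16_le_sixteen_of_hb : ∀ c : Cell, hb c = true → heavy c = false → phi16 c ≤ 16 := by decide

/-- the heavy shapes really are heavy (`Φ′ > 1`), so the exclusion in (T1) is sharp. -/
theorem sixteen_lt_phi16_of_heavy : ∀ c : Cell, heavy c = true → 16 < phi16 c := by decide

/-- **(T3)** `Φ′ = 0` on every axis cell (letters `u A C H` only); in particular on `u⁴, Auuu, AAuu, AAAu, AAAA, Cuuu`. -/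
theorem phi16_axis : ∀ c : Cell, axisCell c = true → phi16 c = 0 := by decide

/-- H-bearing cells have `ρ = 0`. -/
theorem rho_hb : ∀ c : Cell, hb c = true → rho c = 0 := by decide

/-- the table digits quoted on the bus (×2 by negation g22 `nine8_table.py`): `16·Φ′` on the named shapes. -/
theorem table_digits :
    phi16 (A, A, D, H) = 16 ∧ phi16 (D, D, H, H) = 16 ∧ phi16 (B, D, H, u) = 14 ∧ phi16 (A, B, B, H) = 12 ∧
    phi16 (B, B, B, H) = 12 ∧ phi16 (A, A, B, H) = 8 ∧ phi16 (A, D, H, u) = 8 ∧ phi16 (B, B, H, u) = 8 ∧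
    phi16 (B, D, H, H) = 8 ∧ phi16 (B, C, H, u) = 6 ∧ phi16 (A, B, H, u) = 4 ∧ phi16 (B, B, H, H) = 4 ∧
    phi16 (D, H, u, u) = 4 ∧ phi16 (B, H, u, u) = 2 ∧ phi16 (A, A, A, H) = 0 ∧ phi16 (C, D, H, H) = 0 ∧
    phi16 (u, u, u, u) = 0 ∧ rho (u, u, u, u) = 1 ∧ rho (A, u, u, u) = 2 ∧ rho (A, A, u, u) = 4 ∧
    rho (A, A, A, u) = 8 ∧ rho (A, A, A, A) = 16 ∧ phi16 (B, u, u, u) = 12 ∧ phi16 (A, B, u, u) = 22 := by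
  decide

/-! ## §2 The law from the identity (pure bookkeeping over finite supports) -/

section Law

variable {ι κ : Type*}

/-- **NINE-EIGHTHS LAW (abstract form).**  `P`, `N` finite supports with nonnegative masses; `φP, ρP` (`φN, ρN`) the
values of `16·Φ′` and `ρ` on the cells; `hub` marks the H-bearing P cells.  Hypotheses: the identity
`Σ_P m(φ − 18ρ) = Σ_N m(φ − 18ρ)` (16 × (N1)); on N: `ρ = 0` (R1: every N cell has a hub) and `φ ≥ 0` (T2);
on H-bearing P cells `ρ = 0`, `φ ≤ 16` (T1 + the door's exclusion of the heavy shapes); on hub-free P cells `φ = 0`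
(T3: they are axis cells).  Conclusion: `9·S ≤ 8·(H-bearing P mass)` with `S = Σ_{P hub-free} m·ρ`. -/
theorem nine_eighths_law (P : Finset ι) (N : Finset κ) (mP φP ρP : ι → ℤ) (mN φN ρN : κ → ℤ)
    (hub : ι → Prop) [DecidablePred hub]
    (hmP : ∀ i ∈ P, 0 ≤ mP i) (hmN : ∀ k ∈ N, 0 ≤ mN k)
    (hid : ∑ i ∈ P, mP i * (φP i - 18 * ρP i) = ∑ k ∈ N, mN k * (φN k - 18 * ρN k))
    (hNρ : ∀ k ∈ N, ρN k = 0) (hNφ : ∀ k ∈ N, 0 ≤ φN k)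
    (hPhub : ∀ i ∈ P, hub i → ρP i = 0 ∧ φP i ≤ 16) (hPfree : ∀ i ∈ P, ¬hub i → φP i = 0) :
    9 * ∑ i ∈ P.filter (fun i => ¬hub i), mP i * ρP i ≤ 8 * ∑ i ∈ P.filter hub, mP i := by
  classical
  -- N side of the identity is ≥ 0
  have hN : 0 ≤ ∑ k ∈ N, mN k * (φN k - 18 * ρN k) := by
    apply Finset.sum_nonneg
    intro k hk
    have := hNρ k hk; have := hNφ k hk; have := hmN k hk
    rw [hNρ k hk]; nlinarith
  -- split the P side into hub / hub-free
  have hsplit := Finset.sum_filter_add_sum_filter_not P hub (fun i => mP i * (φP i - 18 * ρP i))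
  -- hub part ≤ 16·(hub mass)
  have hhub : ∑ i ∈ P.filter hub, mP i * (φP i - 18 * ρP i) ≤ 16 * ∑ i ∈ P.filter hub, mP i := by
    rw [Finset.mul_sum]
    apply Finset.sum_le_sum
    intro i hi
    rw [Finset.mem_filter] at hi
    obtain ⟨hρ, hφ⟩ := hPhub i hi.1 hi.2
    have := hmP i hi.1
    rw [hρ]; nlinarith
  -- hub-free part = −18·S
  have hfree : ∑ i ∈ P.filter (fun i => ¬hub i), mP i * (φP i - 18 * ρP i)
      = -18 * ∑ i ∈ P.filter (fun i => ¬hub i), mP i * ρP i := by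
    rw [Finset.mul_sum]
    apply Finset.sum_congr rfl
    intro i hi
    rw [Finset.mem_filter] at hi
    rw [hPfree i hi.1 hi.2]; ring
  have key : 0 ≤ ∑ i ∈ P, mP i * (φP i - 18 * ρP i) := hid ▸ hN
  rw [← hsplit, hfree] at key
  linarith

/-- the corollary used on the bus: with hub-free P mass `c ≥ S/2` (each hub-free cell has `ρ ≤ 2` in the R19.701
regime) or `c ≥ 17` ((S2)), the total P mass is `≥ 9S/8 + c`. -/
theorem pmass_floor (HP c S : ℤ) (hlaw : 9 * S ≤ 8 * HP) (c0 : ℤ) (hc : c0 ≤ c) :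
    9 * S + 8 * c0 ≤ 8 * (HP + c) := by linarith

/-- numerics of record: `S ≥ 32 ∧ c ≥ 17 ⇒ Σ_P m ≥ 53 > 50`; `S ≥ 32 ∧ 2c ≥ S ⇒ Σ_P m ≥ 52 > 50`. -/
theorem pmass_floor_digits (HP c S : ℤ) (hlaw : 9 * S ≤ 8 * HP) (hS : 32 ≤ S) :
    (17 ≤ c → 53 ≤ HP + c) ∧ (S ≤ 2 * c → 52 ≤ HP + c) := by
  constructor <;> intro h <;> omega

end Law

/-! ## §3 Shell-generic closed forms (any classes `(r, q) = (col, 2|xy|)`, every shell)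

The same functional with the four slot weights as free integer parameters; the per-shell cell tables of the CORE memo follow from three `ring`
identities: hub-free axis cells give `0`, two-hub cells give `q_a·q_b`, one-hub cells give
`q_a r_b r_c + q_b r_a r_c + q_c r_a r_b + q_a q_b (1 − r_c) + q_a q_c (1 − r_b) + q_b q_c (1 − r_a)`. -/

section Generic

/-- `16·Φ′` with free slot weights `q = (q₁,…,q₄)`, `r = (r₁,…,r₄)` (same placement sum as `Cell.phi16`). -/
def phi16w (qa qb qd qe ra rb rd re : ℤ) : ℤ :=
  ( qa * (rb * rd + rb * re + rd * re)
  + qb * (ra * rd + ra * re + rd * re)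
  + qd * (ra * rb + ra * re + rb * re)
  + qe * (ra * rb + ra * rd + rb * rd) )
  + ( qa * qb + qa * qd + qa * qe + qb * qd + qb * qe + qd * qe )
  - ( qa * qb * (rd + re) + qa * qd * (rb + re) + qa * qe * (rb + rd)
    + qb * qd * (ra + re) + qb * qe * (ra + rd) + qd * qe * (ra + rb) )
  + 3 * ( qa * rb * rd * re + qb * ra * rd * re + qd * ra * rb * re + qe * ra * rb * rd )

/-- the class-cell functional is the generic one at the class weights. -/
theorem phi16_eq_phi16w (c : Cell) :
    phi16 c = phi16w (q c.1) (q c.2.1) (q c.2.2.1) (q c.2.2.2) (r c.1) (r c.2.1) (r c.2.2.1) (r c.2.2.2) := rfl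

/-- AXIS hub-free cells (all `q = 0`): `16Φ′ = 0` at every shell. -/
theorem phi16w_axis (ra rb rd re : ℤ) : phi16w 0 0 0 0 ra rb rd re = 0 := by
  unfold phi16w; ring

/-- THREE hubs: `16Φ′ = 0`. -/
theorem phi16w_three_hub (qa ra : ℤ) : phi16w qa 0 0 0 ra 0 0 0 = 0 := by
  unfold phi16w; ring

/-- TWO hubs (slots 3, 4 the hubs: `q = r = 0` there): `16Φ′ = q_a·q_b` — e.g. shell 4: `DF 24, DG 32, FF 36, FG 48, GG 64 > 16`, `BG = 16`, `BF = 12`, `DD = 16`. -/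
theorem phi16w_two_hub (qa qb ra rb : ℤ) : phi16w qa qb 0 0 ra rb 0 0 = qa * qb := by
  unfold phi16w; ring

/-- ONE hub (slot 4): the one-hub closed form of the CORE memo §2.2. -/
theorem phi16w_one_hub (qa qb qd ra rb rd : ℤ) :
    phi16w qa qb qd 0 ra rb rd 0
      = qa * rb * rd + qb * ra * rd + qd * ra * rb + qa * qb * (1 - rd) + qa * qd * (1 - rb) + qb * qd * (1 - ra) := by
  unfold phi16w; ring

/-- the functional is symmetric under the slot transpositions generating S₄ (so the hub may sit in any slot in the three lemmas above). -/
theorem phi16w_swap12 (qa qb qd qe ra rb rd re : ℤ) :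
    phi16w qa qb qd qe ra rb rd re = phi16w qb qa qd qe rb ra rd re := by unfold phi16w; ring
theorem phi16w_swap23 (qa qb qd qe ra rb rd re : ℤ) :
    phi16w qa qb qd qe ra rb rd re = phi16w qa qd qb qe ra rd rb re := by unfold phi16w; ring
theorem phi16w_swap34 (qa qb qd qe ra rb rd re : ℤ) :
    phi16w qa qb qd qe ra rb rd re = phi16w qa qb qe qd ra rb re rd := by unfold phi16w; ring

/-- shell-4 digits of the CORE memo (classes `E = (4,0)`, `F = (4,6)`, `G = (4,8)`): the N-negative one-hub shapes and the E-shortlist. -/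
theorem shell4_digits :
    phi16w 8 8 8 0 4 4 4 0 = -192 ∧ phi16w 6 8 8 0 4 4 4 0 = -128 ∧ phi16w 6 6 8 0 4 4 4 0 = -76 ∧ phi16w 6 6 6 0 4 4 4 0 = -36 ∧
    phi16w 4 8 8 0 3 4 4 0 = -64 ∧ phi16w 4 6 8 0 3 4 4 0 = -32 ∧ phi16w 4 6 6 0 3 4 4 0 = -8 ∧ phi16w 4 4 8 0 3 3 4 0 = -8 ∧
    phi16w 0 4 0 0 2 3 4 0 = 32 ∧ phi16w 0 0 6 0 1 4 4 0 = 24 ∧ phi16w 2 0 0 0 2 4 4 0 = 32 ∧ phi16w 2 0 0 0 2 3 4 0 = 24 ∧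
    phi16w 4 6 0 0 3 4 0 0 = 24 ∧ phi16w 8 8 0 0 4 4 0 0 = 64 ∧ phi16w 2 8 0 0 2 4 0 0 = 16 := by
  decide

end Generic

end Summit.HodgeConjecture.HodgeConjecture.Cruxes.BlochSeedDiscOne.NineEighths
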